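import Literature.Barriers.CriticalPhenomena.LaceExpansionIsingAboveFourReduction
import Literature.Probability.LatticeModels.AizenmanGrahamInequality
import HarnessLib

/-!
# Aizenman's bubble bound `χ_β ≤ C (β_c - β)⁻¹` from the Aizenman–Graham inequality

Barrier catalogue `Literature/Barriers/CriticalPhenomena/` (D-0021), proof file serving the
discharge of the last named input `SpreadOutIsing.bubble_susceptibility_upper` of the barrier
`LaceExpansionIsingAboveFour` (bubble condition ⇒ `γ ≤ 1` for the uniformly spread-out Ising
model: `B(β_c) < ∞ ⇒ χ_β ≤ C(β_c - β)⁻¹` near `β_c`; Aizenman 1982, Aizenman–Graham 1983, as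
quoted by Sakai 2007, §1.1: "the finiteness of `Σ_{x∈ℤ^d} G_{p_c}(x)²` … implies that … `γ = 1`").
This file PROVES

* `bubble_susceptibility_upper_of_aizenmanGraham`:
  `(∀ d L n β, aizenmanGraham_inequality (spreadOutGraph d L) (box d n) β) → bubble_susceptibility_upper`,

i.e. it reduces Aizenman's bound to the finite-volume **Aizenman–Graham inequality** (the named
fact `Literature.Probability.LatticeModels.aizenmanGraham_inequality`, Tasaki–Hara 2015,
Thm. A.18 (A.125)) in the boxes of the model, following the proof of Theorem 10.13 of

* H. Tasaki, T. Hara, *相転移と臨界現象の数理*, Kyoritsu 2015, Ch. 10 §3.3, eqs. (10.63)–(10.69)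
  [TasakiHara2015] ("`γ = 1` の証明の概略 … [52] に沿って"): write
  `∂_β⟨σ_oσ_x⟩ = Σ_{{u,v}} {⟨σ_oσ_u⟩⟨σ_xσ_v⟩ + ⟨σ_oσ_v⟩⟨σ_xσ_u⟩ + u⁽⁴⁾(o,x,u,v)}` (10.63); bound
  `-Σ_{{u,v},x} u⁽⁴⁾(o,x,u,v) ≤ {2 tanh β Σ_{{w,z},x} ⟨σ_oσ_x;σ_wσ_z⟩ + 2 Σ_x⟨σ_oσ_x⟩} Σ_{{u,v}}⟨σ_oσ_u⟩⟨σ_oσ_v⟩`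
  by the Aizenman–Graham inequality (10.65)–(10.66), with `Σ_{{u,v}}⟨σ_oσ_u⟩⟨σ_oσ_v⟩ ≤ d B_L(β)`
  (Schwarz, (10.67)); solve for the derivative (10.68)–(10.69),
  `d/dβ(β/χ) ≤ (-2d + 2dB β/χ)/(1 + 2 tanh β B)`, and "integrate in `β`".

## The argument as formalised (free boundary condition)

Tasaki–Hara work with periodic boundary conditions, where `Σ_x ⟨σ_vσ_x⟩_Λ` does not depend on
`v`. The tree's spread-out two-point function `spreadOutTwoPoint` is the monotone limit of
FREE-boundary box correlations, so the finite-volume inequality is derived here for the free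
state of a box `Λ = Λ_n` and the volume limit is taken afterwards:

1. **General finite volume** (any locally finite graph `G`, volume `Λ ∋ o`, `β ≥ 0`;
   `S_v = Σ_{y∈Λ} ⟨σ_vσ_y⟩_Λ` is the tree's `volumeSusceptibility`):
   `dS_o/dβ = M_Λ(o) + ½ Σ_y Σ_{(u,v)} u⁽⁴⁾(o,y,u,v)` with the driving term
   `M_Λ(o) = Σ_{(u,v)} ⟨σ_oσ_u⟩ S_v` (ordered adjacent pairs; `deriv_volumeSusceptibility_eq_drivingTerm_add`,
   from the tree's `hasDerivAt_isingTwoPoint_free`), and, granted `aizenmanGraham_inequality G Λ β`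
   and a bound `b_Λ(z) = Σ_{(u,v)} ⟨σ_uσ_z⟩⟨σ_vσ_z⟩ ≤ B` (`edgeBubble`),
   `-½ ΣΣ u⁽⁴⁾ ≤ tanh β · B · dS_o/dβ + B S_o` (`neg_sum_ursellFour_le`: AG at `(u,v,o,y)`, the
   legs `⟨σ_uσ_z⟩⟨σ_vσ_z⟩` summing to `b_Λ(z)`, the raw truncated correlations
   `⟨σ_wσ_z;σ_oσ_y⟩ ≥ 0` (GKS II) summing to the derivative, the reducible terms to `≤ B S_o`);
   hence `M_Λ(o) - B S_o ≤ (1 + tanh β B) dS_o/dβ` (`drivingTerm_sub_le_deriv_volumeSusceptibility`).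
2. **Boxes of the spread-out model**, `0 ≤ β ≤ β_c`, `B(β_c) < ∞`: `b_{Λ_n}(z) ≤ |J| Σ_u ⟨σ_uσ_z⟩² ≤
   |J| B(β) ≤ |J| B(β_c) =: B₂` (`⟨σ_uσ_z⟩_{Λ_n} ≤ G_β(z-u)`, GKS), `tanh β ≤ 1`, and the mean value
   theorem give `(β₂-β₁)(M_{Λ_n}(β₁) - B₂ S_0^{Λ_n}(β₂)) ≤ (1+B₂)(S_0^{Λ_n}(β₂) - S_0^{Λ_n}(β₁))`
   for `0 ≤ β₁ ≤ β₂ ≤ β_c` (`boxSusceptibility_increment_ge`; `M` and `S` nondecreasing in `β`).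
3. **Volume limit**: `M_{Λ_n}(β) ≥ |J| (S_0^{Λ_m}(β))²` for `n ≥ 2m + L` (translation and GKS volume
   monotonicity, `degree_mul_sq_le_drivingTerm`) and `S_0^{Λ_n}(β) ↑ χ_β < ∞` for `β < β_c`
   (`tendsto_boxSusceptibility`) give `(β₂-β₁)(|J|χ_{β₁}² - B₂χ_{β₂}) ≤ (1+B₂)(χ_{β₂} - χ_{β₁})`
   (`susceptibility_increment_ge`).
4. **Integration without differentiability** (`le_inv_of_increment_ge`): for `χ ≥ 1` nondecreasing
   with `|J|χ(β₀) ≥ 2B₂`, this increment bound telescopes over fine partitions to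
   `1/χ_β ≥ (|J|/(2(1+B₂)))(β_c - β)`, i.e. `χ_β ≤ C(β_c - β)⁻¹` with `C = 2(1 + |J|B(β_c))/|J|` on
   `[β₀, β_c)`; `β₀` exists because `χ_β ↑ ∞` (`susceptibility_unbounded_below_critBeta_holds`).

Nothing in the barrier files is restated; `volumeSusceptibility`, `boxTwoPoint`, GKS and the
transport lemmas are the tree's. NOT here: the proof of the Aizenman–Graham inequality itself
(random currents, Tasaki–Hara App. A §3.6), which is the business of
`Literature/Probability/LatticeModels/AizenmanGrahamInequality*.lean`; once
`aizenmanGraham_inequality_holds` lands, `bubble_susceptibility_upper_holds` is one line.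

## References

* H. Tasaki, T. Hara, 相転移と臨界現象の数理, Kyoritsu Shuppan 2015, Ch. 10 §3.3 (Thm. 10.13,
  (10.63)–(10.69)), App. A Thm. A.18 (A.125) [TasakiHara2015].
* A. Sakai, Comm. Math. Phys. 272 (2007) 283–344, §1.1 [Sakai2007].
* M. Aizenman, R. Graham, Nucl. Phys. B 225 (1983) 261–288 [AizenmanGraham1983];
  M. Aizenman, Comm. Math. Phys. 86 (1982) 1–48 [Aizenman1982].
* H. Duminil-Copin, ICM 2022, §7.1 (`(1 - B/χ)·2dχ²/(1+B) ≤ ∂_βχ`) [DuminilCopinICM2022].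
* S. Friedli, Y. Velenik, *Statistical Mechanics of Lattice Systems*, CUP 2017, Thm. 3.20,
  Exercises 3.12–3.13 [FriedliVelenik2017].
-/

noncomputable section

namespace Literature.Barriers.CriticalPhenomena.SpreadOutIsing

open MeasureTheory Filter Topology Finset Literature.Probability.LatticeModels Literature.Probability.Percolation
open scoped ENNReal BigOperators symmDiff

/-! ## Part A. A general finite volume: the Aizenman–Graham bound on `dS_o/dβ` from below -/

section General

variable {V : Type*} [DecidableEq V] (G : SimpleGraph V) [G.LocallyFinite] [DecidableRel G.Adj]

/-- The **edge bubble at `z`** of a finite volume: `b_Λ(z) = Σ_{u∈Λ} Σ_{v∈Λ, v∼u} ⟨σ_uσ_z⟩_Λ ⟨σ_vσ_z⟩_Λ`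
(ordered pairs of adjacent vertices; free boundary condition, zero field) — the quantity
`Σ_{{u,v}} ⟨σ_oσ_u⟩⟨σ_oσ_v⟩ ≤ d·B_L(β)` of Tasaki–Hara, eq. (10.67), counted over ordered pairs.
[cite: TasakiHara2015, Ch. 10, eqs. (10.66)–(10.67)] -/
def edgeBubble (Λ : Finset V) (β : ℝ) (z : V) : ℝ :=
  ∑ u ∈ Λ, ∑ v ∈ Λ with G.Adj u v, isingTwoPoint G Λ β 0 .free u z * isingTwoPoint G Λ β 0 .free v z

/-- The **driving term** `M_Λ(o) = Σ_{u∈Λ} Σ_{v∈Λ, v∼u} ⟨σ_oσ_u⟩_Λ S_v`, `S_v = Σ_{y∈Λ} ⟨σ_vσ_y⟩_Λ`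
the finite-volume susceptibility seen from `v`: the Gaussian part `Σ_{{u,v}}(⟨σ_oσ_u⟩⟨σ_xσ_v⟩ +
⟨σ_oσ_v⟩⟨σ_xσ_u⟩)` of `∂_β Σ_x ⟨σ_oσ_x⟩` (Tasaki–Hara, eq. (10.63)), summed over `x`.
[cite: TasakiHara2015, Ch. 10, eq. (10.63)] -/
def drivingTerm (Λ : Finset V) (β : ℝ) (o : V) : ℝ :=
  ∑ u ∈ Λ, ∑ v ∈ Λ with G.Adj u v, isingTwoPoint G Λ β 0 .free o u * volumeSusceptibility G Λ β v

variable (Λ : Finset V) (β h : ℝ) (bc : BoundaryCondition V)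

omit [DecidableRel G.Adj] in
/-- `⟨σ_uσ_v ; σ_oσ_y⟩ = ⟨σ_oσ_u⟩⟨σ_yσ_v⟩ + ⟨σ_oσ_v⟩⟨σ_yσ_u⟩ + u⁽⁴⁾(o,y,u,v)` (the rewriting
(10.63) of the `β`-derivative in terms of the connected four-point function).
[cite: TasakiHara2015, Ch. 10, eq. (10.63)] -/
theorem isingPairCov_eq_add_ursellFour (u v o y : V) :
    isingPairCov G Λ β h bc u v o y =
      isingTwoPoint G Λ β h bc o u * isingTwoPoint G Λ β h bc y v +
        isingTwoPoint G Λ β h bc o v * isingTwoPoint G Λ β h bc y u +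
          isingUrsellFour G Λ β h bc o y u v := by
  unfold isingPairCov isingUrsellFour
  rw [isingFourPoint_swap G Λ β h bc u v o y]
  ring

omit [DecidableRel G.Adj] in
/-- `u⁽⁴⁾` is symmetric under the exchange of its two pairs of arguments. [cite: TasakiHara2015, App. A, eq. (A.123)] -/
theorem isingUrsellFour_swap (x₁ x₂ x₃ x₄ : V) :
    isingUrsellFour G Λ β h bc x₁ x₂ x₃ x₄ = isingUrsellFour G Λ β h bc x₃ x₄ x₁ x₂ := by
  unfold isingUrsellFour
  rw [isingFourPoint_swap G Λ β h bc x₁ x₂ x₃ x₄, isingTwoPoint_symm G Λ β h bc x₃ x₁,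
    isingTwoPoint_symm G Λ β h bc x₄ x₂, isingTwoPoint_symm G Λ β h bc x₃ x₂,
    isingTwoPoint_symm G Λ β h bc x₄ x₁]
  ring

variable {Λ β}

omit [DecidableRel G.Adj] in
/-- **`⟨σ_uσ_v ; σ_xσ_y⟩^∅_{Λ;β,0} ≥ 0`** for `β ≥ 0` and `u, v, x, y ∈ Λ` (GKS II:
`⟨σ_Aσ_B⟩ ≥ ⟨σ_A⟩⟨σ_B⟩` with `σ_uσ_v = σ_{{u}Δ{v}}`). [cite: FriedliVelenik2017, Thm. 3.20, eq. (3.22)] -/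
theorem isingPairCov_free_nonneg (hβ : 0 ≤ β) {u v x y : V} (hu : u ∈ Λ) (hv : v ∈ Λ)
    (hx : x ∈ Λ) (hy : y ∈ Λ) : 0 ≤ isingPairCov G Λ β 0 .free u v x y := by
  have hprod : (fun σ : SpinConfig V => spinPair u v σ * spinPair x y σ) =
      spinProduct (({u} ∆ {v}) ∆ ({x} ∆ {y})) := by
    funext σ
    rw [spinPair_eq_spinProduct_symmDiff u v, spinPair_eq_spinProduct_symmDiff x y,
      spinProduct_mul_spinProduct]
  have hA : ({u} ∆ {v} : Finset V) ⊆ Λ := fun w hw => by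
    rcases Finset.mem_symmDiff.1 hw with ⟨h1, -⟩ | ⟨h1, -⟩
    · rw [Finset.mem_singleton.1 h1]; exact hu
    · rw [Finset.mem_singleton.1 h1]; exact hv
  have hB : ({x} ∆ {y} : Finset V) ⊆ Λ := fun w hw => by
    rcases Finset.mem_symmDiff.1 hw with ⟨h1, -⟩ | ⟨h1, -⟩
    · rw [Finset.mem_singleton.1 h1]; exact hx
    · rw [Finset.mem_singleton.1 h1]; exact hy
  have h := Literature.Probability.LatticeModels.GKSInequalities.gks_two_holds G
    (Λ := Λ) (A := {u} ∆ {v}) (B := {x} ∆ {y}) (β := β) (h := 0) (bc := .free)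
    hβ le_rfl (Or.inl rfl) hA hB
  unfold isingPairCov isingFourPoint
  rw [hprod, isingTwoPoint_eq_isingCorr_symmDiff, isingTwoPoint_eq_isingCorr_symmDiff]
  change isingCorr G Λ β 0 .free ({u} ∆ {v}) * isingCorr G Λ β 0 .free ({x} ∆ {y}) ≤
    isingCorr G Λ β 0 .free (({u} ∆ {v}) ∆ ({x} ∆ {y})) at h
  unfold isingCorr at h ⊢
  linarith

/-- The edge bubble is nonnegative for `β ≥ 0` (`z ∈ Λ`). [cite: FriedliVelenik2017, Thm. 3.20] -/
theorem edgeBubble_nonneg (hβ : 0 ≤ β) {z : V} (hz : z ∈ Λ) : 0 ≤ edgeBubble G Λ β z :=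
  Finset.sum_nonneg fun _ hu => Finset.sum_nonneg fun _ hv =>
    mul_nonneg (isingTwoPoint_free_nonneg G hβ hu hz)
      (isingTwoPoint_free_nonneg G hβ (Finset.mem_filter.1 hv).1 hz)

/-- A sum over ordered pairs of adjacent vertices of `Λ` is symmetric under the exchange of the
two summation variables. [folklore] -/
theorem sum_adj_swap (f : V → V → ℝ) :
    ∑ u ∈ Λ, ∑ v ∈ Λ with G.Adj u v, f u v = ∑ u ∈ Λ, ∑ v ∈ Λ with G.Adj u v, f v u := by
  rw [← sum_edgesIn_lift_eq G Λ f, ← sum_edgesIn_lift_eq G Λ (fun u v => f v u)]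
  refine Finset.sum_congr rfl fun e _ => ?_
  induction e using Sym2.ind with
  | _ a b => simp only [Sym2.lift_mk]; ring

variable (Λ β) in
/-- **The `β`-derivative of the finite-volume susceptibility as a sum of truncated pair–pair
correlations**: `dS_o/dβ = ½ Σ_{y∈Λ} Σ_{u∈Λ} Σ_{v∈Λ, v∼u} ⟨σ_uσ_v ; σ_oσ_y⟩_Λ` (ordered pairs, each
edge twice; Friedli–Velenik 2017, Exercise 3.13; Tasaki–Hara (8.6)/(10.63)).
[cite: TasakiHara2015, Ch. 10, eq. (10.63)] -/
theorem deriv_volumeSusceptibility_eq_sum_pairCov (o : V) :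
    deriv (fun β => volumeSusceptibility G Λ β o) β =
      (1 / 2) * ∑ y ∈ Λ, ∑ u ∈ Λ, ∑ v ∈ Λ with G.Adj u v, isingPairCov G Λ β 0 .free u v o y := by
  rw [(hasDerivAt_volumeSusceptibility G Λ β o).deriv, Finset.mul_sum]
  refine Finset.sum_congr rfl fun y _ => ?_
  rw [(hasDerivAt_isingTwoPoint_free G Λ β o y).deriv,
    ← sum_edgesIn_lift_eq G Λ (fun u v => isingPairCov G Λ β 0 .free u v o y), Finset.mul_sum]
  refine Finset.sum_congr rfl fun e _ => ?_
  induction e using Sym2.ind with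
  | _ a b =>
    rw [Sym2.lift_mk]
    have h1 : (fun σ : SpinConfig V => bondSpin σ s(a, b) * spinPair o y σ) =
        fun σ => spinPair a b σ * spinPair o y σ := by
      funext σ; simp only [bondSpin_mk, spinPair]
    have h2 : (fun σ : SpinConfig V => bondSpin σ s(a, b)) = spinPair a b := by
      funext σ; simp only [bondSpin_mk, spinPair]
    rw [h1, h2]
    change _ = 1 / 2 * (isingPairCov G Λ β 0 .free a b o y + isingPairCov G Λ β 0 .free b a o y)
    rw [isingPairCov_comm12 G Λ β 0 .free b a o y]
    simp only [isingPairCov, isingFourPoint, isingTwoPoint]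
    ring

omit [DecidableEq V] [G.LocallyFinite] in
/-- A double sum over ordered pairs of adjacent vertices of `Λ` is a sum over the finite set of
such pairs. [folklore] -/
theorem sum_adj_eq_sum_filter_prod (f : V → V → ℝ) :
    ∑ u ∈ Λ, ∑ v ∈ Λ with G.Adj u v, f u v =
      ∑ p ∈ (Λ ×ˢ Λ).filter (fun p : V × V => G.Adj p.1 p.2), f p.1 p.2 := by
  rw [Finset.sum_filter, Finset.sum_product]
  refine Finset.sum_congr rfl fun u _ => ?_
  rw [Finset.sum_filter]

variable (Λ β) in
/-- **Gaussian part plus connected part**: `dS_o/dβ = M_Λ(o) + ½ Σ_y Σ_u Σ_{v∼u} u⁽⁴⁾(o,y,u,v)`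
(Tasaki–Hara, eqs. (10.63)–(10.64): the derivative splits into the product of two-point
functions, summing to the driving term, and the connected four-point function).
[cite: TasakiHara2015, Ch. 10, eqs. (10.63)–(10.64)] -/
theorem deriv_volumeSusceptibility_eq_drivingTerm_add (o : V) :
    deriv (fun β => volumeSusceptibility G Λ β o) β =
      drivingTerm G Λ β o +
        (1 / 2) * ∑ y ∈ Λ, ∑ u ∈ Λ, ∑ v ∈ Λ with G.Adj u v, isingUrsellFour G Λ β 0 .free o y u v := by
  rw [deriv_volumeSusceptibility_eq_sum_pairCov]
  simp_rw [isingPairCov_eq_add_ursellFour, Finset.sum_add_distrib]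
  -- the two Gaussian sums both equal the driving term
  have hS : ∀ v : V, volumeSusceptibility G Λ β v = ∑ y ∈ Λ, isingTwoPoint G Λ β 0 .free y v := by
    intro v
    unfold volumeSusceptibility
    exact Finset.sum_congr rfl fun y _ => isingTwoPoint_symm G Λ β 0 .free v y
  have h1 : ∑ y ∈ Λ, ∑ u ∈ Λ, ∑ v ∈ Λ with G.Adj u v,
      isingTwoPoint G Λ β 0 .free o u * isingTwoPoint G Λ β 0 .free y v = drivingTerm G Λ β o := by
    rw [Finset.sum_comm]
    unfold drivingTerm
    refine Finset.sum_congr rfl fun u _ => ?_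
    rw [Finset.sum_comm]
    refine Finset.sum_congr rfl fun v _ => ?_
    rw [hS v, Finset.mul_sum]
  have h2 : ∑ y ∈ Λ, ∑ u ∈ Λ, ∑ v ∈ Λ with G.Adj u v,
      isingTwoPoint G Λ β 0 .free o v * isingTwoPoint G Λ β 0 .free y u = drivingTerm G Λ β o := by
    rw [← h1]
    refine Finset.sum_congr rfl fun y _ => ?_
    exact sum_adj_swap G (fun u v => isingTwoPoint G Λ β 0 .free o v * isingTwoPoint G Λ β 0 .free y u)
  rw [h1, h2]
  ring

/-- **The Aizenman–Graham inequality summed over the volume and the edges** (Tasaki–Hara,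
eq. (10.66), free boundary condition): if `b_Λ(z) ≤ B` for all `z ∈ Λ`, then for `o ∈ Λ`
`-½ Σ_y Σ_u Σ_{v∼u} u⁽⁴⁾(o,y,u,v) ≤ tanh β · B · dS_o/dβ + B · S_o` — the bubble legs
`⟨σ_uσ_z⟩⟨σ_vσ_z⟩` of (A.125) (applied to `(u,v,o,y)`) sum to `b_Λ(z) ≤ B`, the raw truncated
correlations `⟨σ_wσ_z;σ_oσ_y⟩ ≥ 0` sum to `dS_o/dβ`, and the reducible terms to `≤ 2B·S_o/2`.
[cite: TasakiHara2015, Ch. 10, eq. (10.66) with App. A, Thm. A.18 (A.125)] -/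
theorem neg_sum_ursellFour_le (hAG : aizenmanGraham_inequality G Λ β) (hβ : 0 ≤ β) {o : V}
    (ho : o ∈ Λ) {B : ℝ} (hB : ∀ z ∈ Λ, edgeBubble G Λ β z ≤ B) :
    -((1 / 2) * ∑ y ∈ Λ, ∑ u ∈ Λ, ∑ v ∈ Λ with G.Adj u v, isingUrsellFour G Λ β 0 .free o y u v) ≤
      Real.tanh β * B * deriv (fun β => volumeSusceptibility G Λ β o) β +
        B * volumeSusceptibility G Λ β o := by
  set T := fun a b : V => isingTwoPoint G Λ β 0 .free a b with hT
  have hB0 : 0 ≤ B := (edgeBubble_nonneg G hβ ho).trans (hB o ho)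
  have hτ : 0 ≤ Real.tanh β := by
    rw [Real.tanh_eq_sinh_div_cosh]
    exact div_nonneg (Real.sinh_nonneg_iff.2 hβ) (Real.cosh_pos β).le
  have hTnn : ∀ a ∈ Λ, ∀ b ∈ Λ, 0 ≤ T a b := fun a ha b hb => isingTwoPoint_free_nonneg G hβ ha hb
  -- the Aizenman–Graham minorant, pointwise
  have hpt : ∀ y ∈ Λ, ∀ u ∈ Λ, ∀ v ∈ Λ,
      -isingUrsellFour G Λ β 0 .free o y u v ≤
        Real.tanh β * ∑ w ∈ Λ, ∑ z ∈ Λ with G.Adj w z,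
            T u z * T v z * isingPairCov G Λ β 0 .free w z o y +
          T u o * T v o * T y o + T u y * T v y * T o y := by
    intro y hy u hu v hv
    have h := hAG hβ hu hv ho hy
    rw [isingUrsellFour_swap G Λ β 0 .free o y u v]
    simp only [hT]
    linarith
  -- sum it
  have hsum : -((1 / 2) * ∑ y ∈ Λ, ∑ u ∈ Λ, ∑ v ∈ Λ with G.Adj u v, isingUrsellFour G Λ β 0 .free o y u v) ≤
      (1 / 2) * ∑ y ∈ Λ, ∑ u ∈ Λ, ∑ v ∈ Λ with G.Adj u v,
        (Real.tanh β * ∑ w ∈ Λ, ∑ z ∈ Λ with G.Adj w z,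
            T u z * T v z * isingPairCov G Λ β 0 .free w z o y +
          T u o * T v o * T y o + T u y * T v y * T o y) := by
    rw [neg_mul_eq_mul_neg, ← Finset.sum_neg_distrib]
    refine mul_le_mul_of_nonneg_left (Finset.sum_le_sum fun y hy => ?_) (by norm_num)
    rw [← Finset.sum_neg_distrib]
    refine Finset.sum_le_sum fun u hu => ?_
    rw [← Finset.sum_neg_distrib]
    exact Finset.sum_le_sum fun v hv => hpt y hy u hu v (Finset.mem_filter.1 hv).1
  refine hsum.trans ?_
  simp only [Finset.sum_add_distrib, mul_add]
  -- Term 1: the bubble legs and the truncated correlations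
  have hD : ∀ w ∈ Λ, ∀ z ∈ Λ, 0 ≤ ∑ y ∈ Λ, isingPairCov G Λ β 0 .free w z o y :=
    fun w hw z hz => Finset.sum_nonneg fun y hy => isingPairCov_free_nonneg G hβ hw hz ho hy
  have h1 : (1 / 2) * ∑ y ∈ Λ, ∑ u ∈ Λ, ∑ v ∈ Λ with G.Adj u v,
      (Real.tanh β * ∑ w ∈ Λ, ∑ z ∈ Λ with G.Adj w z,
        T u z * T v z * isingPairCov G Λ β 0 .free w z o y) ≤
      Real.tanh β * B * deriv (fun β => volumeSusceptibility G Λ β o) β := by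
    set P := (Λ ×ˢ Λ).filter (fun p : V × V => G.Adj p.1 p.2) with hP_def
    have hP : ∀ g : V → V → ℝ, ∑ u ∈ Λ, ∑ v ∈ Λ with G.Adj u v, g u v = ∑ p ∈ P, g p.1 p.2 :=
      fun g => sum_adj_eq_sum_filter_prod G g
    have hPmem : ∀ p ∈ P, p.1 ∈ Λ ∧ p.2 ∈ Λ := fun p hp => by
      rw [hP_def, Finset.mem_filter, Finset.mem_product] at hp
      exact hp.1
    have hbub : ∀ z : V, ∑ p ∈ P, T p.1 z * T p.2 z = edgeBubble G Λ β z := fun z => by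
      rw [edgeBubble, hP]
    -- rewrite with sums over `P` and exchange
    have hex : (1 / 2) * ∑ y ∈ Λ, ∑ u ∈ Λ, ∑ v ∈ Λ with G.Adj u v,
        (Real.tanh β * ∑ w ∈ Λ, ∑ z ∈ Λ with G.Adj w z,
          T u z * T v z * isingPairCov G Λ β 0 .free w z o y) =
        (Real.tanh β / 2) * ∑ q ∈ P, edgeBubble G Λ β q.2 *
          ∑ y ∈ Λ, isingPairCov G Λ β 0 .free q.1 q.2 o y := by
      have hstep : ∀ y : V, ∑ u ∈ Λ, ∑ v ∈ Λ with G.Adj u v,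
          (Real.tanh β * ∑ w ∈ Λ, ∑ z ∈ Λ with G.Adj w z,
            T u z * T v z * isingPairCov G Λ β 0 .free w z o y) =
          Real.tanh β * ∑ q ∈ P, edgeBubble G Λ β q.2 * isingPairCov G Λ β 0 .free q.1 q.2 o y := by
        intro y
        rw [hP (fun u v => Real.tanh β * ∑ w ∈ Λ, ∑ z ∈ Λ with G.Adj w z,
          T u z * T v z * isingPairCov G Λ β 0 .free w z o y), ← Finset.mul_sum]
        congr 1
        have : ∀ p ∈ P, ∑ w ∈ Λ, ∑ z ∈ Λ with G.Adj w z,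
            T p.1 z * T p.2 z * isingPairCov G Λ β 0 .free w z o y =
            ∑ q ∈ P, T p.1 q.2 * T p.2 q.2 * isingPairCov G Λ β 0 .free q.1 q.2 o y :=
          fun p _ => hP (fun w z => T p.1 z * T p.2 z * isingPairCov G Λ β 0 .free w z o y)
        rw [Finset.sum_congr rfl this, Finset.sum_comm]
        refine Finset.sum_congr rfl fun q _ => ?_
        rw [← hbub q.2, Finset.sum_mul]
      simp_rw [hstep]
      rw [← Finset.mul_sum, Finset.sum_comm]
      simp_rw [Finset.mul_sum]
      ring
    rw [hex]
    have hderiv : deriv (fun β => volumeSusceptibility G Λ β o) β =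
        (1 / 2) * ∑ y ∈ Λ, ∑ q ∈ P, isingPairCov G Λ β 0 .free q.1 q.2 o y := by
      rw [deriv_volumeSusceptibility_eq_sum_pairCov]
      congr 1
      exact Finset.sum_congr rfl fun y _ => hP (fun u v => isingPairCov G Λ β 0 .free u v o y)
    rw [hderiv]
    have hbound : ∑ q ∈ P, edgeBubble G Λ β q.2 * ∑ y ∈ Λ, isingPairCov G Λ β 0 .free q.1 q.2 o y ≤
        B * ∑ y ∈ Λ, ∑ q ∈ P, isingPairCov G Λ β 0 .free q.1 q.2 o y :=
      calc ∑ q ∈ P, edgeBubble G Λ β q.2 * ∑ y ∈ Λ, isingPairCov G Λ β 0 .free q.1 q.2 o y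
          ≤ ∑ q ∈ P, B * ∑ y ∈ Λ, isingPairCov G Λ β 0 .free q.1 q.2 o y :=
            Finset.sum_le_sum fun q hq => mul_le_mul_of_nonneg_right (hB q.2 (hPmem q hq).2)
              (hD q.1 (hPmem q hq).1 q.2 (hPmem q hq).2)
        _ = B * ∑ q ∈ P, ∑ y ∈ Λ, isingPairCov G Λ β 0 .free q.1 q.2 o y := by rw [← Finset.mul_sum]
        _ = B * ∑ y ∈ Λ, ∑ q ∈ P, isingPairCov G Λ β 0 .free q.1 q.2 o y := by rw [Finset.sum_comm]
    calc Real.tanh β / 2 * ∑ q ∈ P, edgeBubble G Λ β q.2 *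
          ∑ y ∈ Λ, isingPairCov G Λ β 0 .free q.1 q.2 o y
        ≤ Real.tanh β / 2 * (B * ∑ y ∈ Λ, ∑ q ∈ P, isingPairCov G Λ β 0 .free q.1 q.2 o y) :=
          mul_le_mul_of_nonneg_left hbound (div_nonneg hτ (by norm_num : (0 : ℝ) ≤ 2))
      _ = _ := by ring
  -- Term 2: the reducible terms `⟨uo⟩⟨vo⟩⟨yo⟩`
  have h2 : (1 / 2) * ∑ y ∈ Λ, ∑ u ∈ Λ, ∑ v ∈ Λ with G.Adj u v, T u o * T v o * T y o ≤
      (1 / 2) * (B * volumeSusceptibility G Λ β o) := by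
    refine mul_le_mul_of_nonneg_left ?_ (by norm_num)
    have heq : ∑ y ∈ Λ, ∑ u ∈ Λ, ∑ v ∈ Λ with G.Adj u v, T u o * T v o * T y o =
        edgeBubble G Λ β o * volumeSusceptibility G Λ β o := by
      unfold edgeBubble volumeSusceptibility
      rw [Finset.mul_sum]
      refine Finset.sum_congr rfl fun y _ => ?_
      rw [Finset.sum_mul]
      refine Finset.sum_congr rfl fun u _ => ?_
      rw [Finset.sum_mul]
      refine Finset.sum_congr rfl fun v _ => ?_
      simp only [hT]
      rw [isingTwoPoint_symm G Λ β 0 .free y o]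
    rw [heq]
    exact mul_le_mul_of_nonneg_right (hB o ho)
      (Finset.sum_nonneg fun y hy => hTnn o ho y hy)
  -- Term 3: the reducible terms `⟨uy⟩⟨vy⟩⟨oy⟩`
  have h3 : (1 / 2) * ∑ y ∈ Λ, ∑ u ∈ Λ, ∑ v ∈ Λ with G.Adj u v, T u y * T v y * T o y ≤
      (1 / 2) * (B * volumeSusceptibility G Λ β o) := by
    refine mul_le_mul_of_nonneg_left ?_ (by norm_num)
    have heq : ∑ y ∈ Λ, ∑ u ∈ Λ, ∑ v ∈ Λ with G.Adj u v, T u y * T v y * T o y =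
        ∑ y ∈ Λ, T o y * edgeBubble G Λ β y := by
      refine Finset.sum_congr rfl fun y _ => ?_
      unfold edgeBubble
      rw [Finset.mul_sum]
      refine Finset.sum_congr rfl fun u _ => ?_
      rw [Finset.mul_sum]
      refine Finset.sum_congr rfl fun v _ => ?_
      simp only [hT]; ring
    rw [heq, volumeSusceptibility, Finset.mul_sum]
    refine Finset.sum_le_sum fun y hy => ?_
    rw [mul_comm B]
    exact mul_le_mul_of_nonneg_left (hB y hy) (hTnn o ho y hy)
  linarith

/-- **The finite-volume Aizenman–Graham differential inequality** (free boundary condition;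
Tasaki–Hara, eqs. (10.64)–(10.68) before the periodic-boundary simplifications): if
`b_Λ(z) ≤ B` on `Λ` and `o ∈ Λ`, then
`(1 + tanh β · B) · dS_o/dβ ≥ M_Λ(o) - B · S_o`.
[cite: TasakiHara2015, Ch. 10, eqs. (10.64)–(10.68)] -/
theorem drivingTerm_sub_le_deriv_volumeSusceptibility (hAG : aizenmanGraham_inequality G Λ β)
    (hβ : 0 ≤ β) {o : V} (ho : o ∈ Λ) {B : ℝ} (hB : ∀ z ∈ Λ, edgeBubble G Λ β z ≤ B) :
    drivingTerm G Λ β o - B * volumeSusceptibility G Λ β o ≤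
      (1 + Real.tanh β * B) * deriv (fun β => volumeSusceptibility G Λ β o) β := by
  have h1 := deriv_volumeSusceptibility_eq_drivingTerm_add G Λ β o
  have h2 := neg_sum_ursellFour_le G hAG hβ ho hB
  linarith

/-- The edge bubble is bounded by the degree times the on-site squares:
`b_Λ(z) ≤ D · Σ_{u∈Λ} ⟨σ_uσ_z⟩²_Λ` when every vertex has at most `D` neighbours
(`2ab ≤ a² + b²`, the Schwarz step of Tasaki–Hara (10.67)). [cite: TasakiHara2015, Ch. 10, eq. (10.67)] -/
theorem edgeBubble_le_degree_mul_sum_sq {D : ℕ} (hdeg : ∀ a, #(G.neighborFinset a) ≤ D) (z : V) :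
    edgeBubble G Λ β z ≤ D * ∑ u ∈ Λ, isingTwoPoint G Λ β 0 .free u z ^ 2 := by
  set a := fun u : V => isingTwoPoint G Λ β 0 .free u z with ha
  have hdegΛ : ∀ u, (#(Λ.filter (G.Adj u)) : ℝ) ≤ D := fun u => by
    have h1 : #(Λ.filter (G.Adj u)) ≤ #(G.neighborFinset u) :=
      Finset.card_le_card fun b hb => by
        rw [SimpleGraph.mem_neighborFinset]; exact (Finset.mem_filter.1 hb).2
    exact_mod_cast h1.trans (hdeg u)
  -- `Σ_u Σ_{v∼u} a_u a_v ≤ Σ_u Σ_{v∼u} (a_u² + a_v²)/2 = Σ_u deg(u) a_u²`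
  calc edgeBubble G Λ β z
      ≤ ∑ u ∈ Λ, ∑ v ∈ Λ with G.Adj u v, (a u ^ 2 + a v ^ 2) / 2 := by
        unfold edgeBubble
        refine Finset.sum_le_sum fun u _ => Finset.sum_le_sum fun v _ => ?_
        simp only [ha]
        nlinarith [sq_nonneg (isingTwoPoint G Λ β 0 .free u z - isingTwoPoint G Λ β 0 .free v z)]
    _ = ∑ u ∈ Λ, ∑ v ∈ Λ with G.Adj u v, a u ^ 2 := by
        rw [show (∑ u ∈ Λ, ∑ v ∈ Λ with G.Adj u v, (a u ^ 2 + a v ^ 2) / 2) =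
            (∑ u ∈ Λ, ∑ v ∈ Λ with G.Adj u v, a u ^ 2 / 2) +
              ∑ u ∈ Λ, ∑ v ∈ Λ with G.Adj u v, a v ^ 2 / 2 by
          rw [← Finset.sum_add_distrib]
          refine Finset.sum_congr rfl fun u _ => ?_
          rw [← Finset.sum_add_distrib]
          refine Finset.sum_congr rfl fun v _ => ?_
          ring]
        rw [← sum_adj_swap G (fun u v => a u ^ 2 / 2), ← Finset.sum_add_distrib]
        refine Finset.sum_congr rfl fun u _ => ?_
        rw [← Finset.sum_add_distrib]
        refine Finset.sum_congr rfl fun v _ => ?_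
        ring
    _ = ∑ u ∈ Λ, #(Λ.filter (G.Adj u)) * a u ^ 2 := by
        refine Finset.sum_congr rfl fun u _ => ?_
        rw [Finset.sum_const, nsmul_eq_mul]
    _ ≤ ∑ u ∈ Λ, D * a u ^ 2 :=
        Finset.sum_le_sum fun u _ => mul_le_mul_of_nonneg_right (hdegΛ u) (sq_nonneg _)
    _ = D * ∑ u ∈ Λ, isingTwoPoint G Λ β 0 .free u z ^ 2 := by rw [Finset.mul_sum]

end General



/-! ## Part B. An elementary comparison lemma: `A(χ(t) - χ(s)) ≥ (t-s)(Jχ(s)² - Bχ(t))` forces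
`χ(β) ≤ (2A/J)(β_c - β)⁻¹` -/

section Comparison

/-- **Discrete Riccati comparison, lower version.** Let `χ ≥ 1` be nondecreasing on `[β₀, β_c)`
with `J χ(β₀) ≥ 2B` (`J > 0`, `B ≥ 0`, `A > 0`) and suppose the increment bound
`A (χ t - χ s) ≥ (t - s)(J χ(s)² - B χ(t))` for `β₀ ≤ s ≤ t < β_c`. Then
`χ(β) ≤ (2A/J)(β_c - β)⁻¹` for every `β ∈ [β₀, β_c)`. (Over a partition of `[β, t]` of mesh
`δ`: `(A + δB)Δᵢ ≥ δ(J/2)χ(tᵢ)²`, so `1/χ(tᵢ) - 1/χ(tᵢ₊₁) ≥ δJ/(2(A+δB)) · (1 - Δᵢ/χ(β))`, which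
telescopes to `1/χ(β) ≥ (J/(2(A+δB)))((t-β) - δ(χ t - χ β)/χ β)`; let `δ → 0`, `t ↑ β_c`. The
integrated form of `d(β/χ)/dβ ≤ (-2d + …)/(1 + 2 tanh β B)` of Tasaki–Hara (10.69), "あとは … β で
「積分」すれば", without differentiability of the infinite-volume `χ`.) [cite: TasakiHara2015, Ch. 10, eq. (10.69) and the integration step after it] -/
theorem le_inv_of_increment_ge {χ : ℝ → ℝ} {β₀ βc A J B : ℝ} (hA : 0 < A) (hJ : 0 < J)
    (hB : 0 ≤ B) (hone : ∀ t, β₀ ≤ t → t < βc → 1 ≤ χ t)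
    (hmono : ∀ s t, β₀ ≤ s → s ≤ t → t < βc → χ s ≤ χ t) (hbig : 2 * B ≤ J * χ β₀)
    (hinc : ∀ s t, β₀ ≤ s → s ≤ t → t < βc →
      (t - s) * (J * χ s ^ 2 - B * χ t) ≤ A * (χ t - χ s))
    {β : ℝ} (hβ₀ : β₀ ≤ β) (hβc : β < βc) :
    χ β ≤ 2 * A / J * (βc - β)⁻¹ := by
  -- Step 1: the telescoped bound for a fixed right end `t` and a fixed mesh
  have hχβ : 1 ≤ χ β := hone β hβ₀ hβc
  have hχβ0 : 0 < χ β := by linarith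
  have key : ∀ t, β < t → t < βc → ∀ k : ℕ, 0 < k →
      J / (2 * (A + (t - β) / k * B)) * ((t - β) - (t - β) / k * (χ t - χ β) / χ β) ≤
        (χ β)⁻¹ - (χ t)⁻¹ := by
    intro t hβt htc k hk
    have hk' : (0 : ℝ) < k := Nat.cast_pos.2 hk
    set δ : ℝ := (t - β) / k with hδ
    have hδ0 : 0 ≤ δ := div_nonneg (by linarith) hk'.le
    set u : ℕ → ℝ := fun i => β + i * δ with hu
    have hu0 : u 0 = β := by simp [hu]
    have huk : u k = t := by simp only [hu, hδ]; field_simp; ring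
    have humem : ∀ i : ℕ, i ≤ k → β ≤ u i ∧ u i ≤ t := by
      intro i hi
      have hi' : (i : ℝ) ≤ k := Nat.cast_le.2 hi
      refine ⟨by simp only [hu]; nlinarith, ?_⟩
      calc u i = β + i * δ := rfl
        _ ≤ β + k * δ := by nlinarith
        _ = t := by simp only [hδ]; field_simp; ring
    set c : ℝ := J / (2 * (A + δ * B)) with hc
    have hAδ : 0 < A + δ * B := by positivity
    have hc0 : 0 ≤ c := div_nonneg hJ.le (by positivity)
    -- one step
    have hstep : ∀ i : ℕ, i < k →
        c * δ * (1 - (χ (u (i + 1)) - χ (u i)) / χ β) ≤ (χ (u i))⁻¹ - (χ (u (i + 1)))⁻¹ := by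
      intro i hi
      obtain ⟨hi1, hi1'⟩ := humem i hi.le
      obtain ⟨hi2, hi2'⟩ := humem (i + 1) hi
      have hle : u i ≤ u (i + 1) := by simp only [hu, Nat.cast_add, Nat.cast_one]; nlinarith
      set p := χ (u i) with hp
      set q := χ (u (i + 1)) with hq
      have hs0 : β₀ ≤ u i := hβ₀.trans hi1
      have hp1 : 1 ≤ p := hone _ hs0 (hi1'.trans_lt htc)
      have hq1 : 1 ≤ q := hone _ (hβ₀.trans hi2) (hi2'.trans_lt htc)
      have hpq : p ≤ q := hmono _ _ hs0 hle (hi2'.trans_lt htc)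
      have hβp : χ β ≤ p := hmono _ _ hβ₀ hi1 (hi1'.trans_lt htc)
      have hp0 : 0 < p := by linarith
      have hq0 : 0 < q := by linarith
      -- the increment bound on `[u i, u (i+1)]`, with `u (i+1) - u i = δ`
      have hincr : δ * (J * p ^ 2 - B * q) ≤ A * (q - p) := by
        have := hinc (u i) (u (i + 1)) hs0 hle (hi2'.trans_lt htc)
        have hts : u (i + 1) - u i = δ := by simp only [hu, Nat.cast_add, Nat.cast_one]; ring
        rwa [hts] at this
      -- absorb `B q = B p + B (q - p)` using `2B ≤ J χ(β₀) ≤ J p`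
      have hBp : 2 * B ≤ J * p := hbig.trans (mul_le_mul_of_nonneg_left
        (hmono _ _ le_rfl hs0 (hi1'.trans_lt htc)) hJ.le)
      have hBp' : B * p ≤ J / 2 * p ^ 2 := by nlinarith [mul_le_mul_of_nonneg_right hBp hp0.le]
      have hmain : δ * (J / 2) * p ^ 2 ≤ (A + δ * B) * (q - p) := by
        have e1 : (A + δ * B) * (q - p) = A * (q - p) + δ * (B * q) - δ * (B * p) := by ring
        have e2 : δ * (B * p) ≤ δ * (J / 2 * p ^ 2) := mul_le_mul_of_nonneg_left hBp' hδ0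
        have e3 : δ * (J * p ^ 2) - δ * (B * q) ≤ A * (q - p) := by nlinarith [hincr]
        rw [e1]
        nlinarith [e2, e3]
      -- divide by `p q`
      have h1 : p⁻¹ - q⁻¹ = (q - p) / (p * q) := by field_simp
      rw [h1, le_div_iff₀ (mul_pos hp0 hq0)]
      have hratio : 1 - (q - p) / χ β ≤ p / q := by
        have h3 : (q - p) / q ≤ (q - p) / χ β :=
          div_le_div_of_nonneg_left (sub_nonneg.2 hpq) hχβ0 (hβp.trans hpq)
        have h4 : 1 - (q - p) / q = p / q := by field_simp; ring
        linarith
      -- `c δ (1 - (q-p)/χβ) (p q) ≤ c δ (p/q) p q = c δ p² ≤ q - p`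
      have hcδ : 0 ≤ c * δ := mul_nonneg hc0 hδ0
      have hpq0 : 0 ≤ p * q := (mul_pos hp0 hq0).le
      calc c * δ * (1 - (q - p) / χ β) * (p * q)
          ≤ c * δ * (p / q) * (p * q) :=
            mul_le_mul_of_nonneg_right (mul_le_mul_of_nonneg_left hratio hcδ) hpq0
        _ = c * (δ * p ^ 2) := by
            have hq' : q ≠ 0 := hq0.ne'
            field_simp
        _ = (δ * (J / 2) * p ^ 2) / (A + δ * B) := by
            rw [hc]
            have hAδ' : A + δ * B ≠ 0 := hAδ.ne'
            field_simp
        _ ≤ q - p := by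
            rw [div_le_iff₀ hAδ]
            linarith [hmain, mul_comm (q - p) (A + δ * B)]
    -- telescope
    have hsum := Finset.sum_le_sum fun i hi => hstep i (Finset.mem_range.1 hi)
    rw [Finset.sum_range_sub' (fun i => (χ (u i))⁻¹) k, hu0, huk] at hsum
    refine le_trans (le_of_eq ?_) hsum
    have hk1 : (k : ℝ) ≠ 0 := hk'.ne'
    have hs2 : ∑ i ∈ Finset.range k, c * δ * (1 - (χ (u (i + 1)) - χ (u i)) / χ β) =
        c * δ * (k - (χ t - χ β) / χ β) := by
      have : ∀ i ∈ Finset.range k, c * δ * (1 - (χ (u (i + 1)) - χ (u i)) / χ β) =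
          c * δ - c * δ / χ β * (χ (u (i + 1)) - χ (u i)) := fun i _ => by ring
      rw [Finset.sum_congr rfl this, Finset.sum_sub_distrib, Finset.sum_const, Finset.card_range,
        ← Finset.mul_sum, Finset.sum_range_sub (fun i => χ (u i)) k, hu0, huk, nsmul_eq_mul]
      field_simp
    rw [hs2]
    simp only [hc, hδ]
    field_simp
  -- Step 2: let the mesh go to zero: `(J/(2A)) (t - β) ≤ 1/χβ - 1/χt ≤ 1/χβ` for `β < t < βc`
  have hlim : ∀ t, β < t → t < βc → J / (2 * A) * (t - β) ≤ (χ β)⁻¹ := by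
    intro t hβt htc
    have hχt : 0 < χ t := by linarith [hone t (by linarith) htc]
    -- the left side of `key` tends to `J/(2A) (t-β)` as `k → ∞`
    have h1 : Tendsto (fun k : ℕ => (t - β) / (k : ℝ)) atTop (𝓝 0) :=
      tendsto_const_nhds.div_atTop tendsto_natCast_atTop_atTop
    have h2 : Tendsto (fun k : ℕ =>
        J / (2 * (A + (t - β) / k * B)) * ((t - β) - (t - β) / k * (χ t - χ β) / χ β)) atTop
        (𝓝 (J / (2 * (A + 0 * B)) * ((t - β) - 0 * (χ t - χ β) / χ β))) := by
      refine Tendsto.mul ?_ ?_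
      · exact tendsto_const_nhds.div (tendsto_const_nhds.mul (tendsto_const_nhds.add
          (h1.mul tendsto_const_nhds))) (by simp [hA.ne'])
      · exact tendsto_const_nhds.sub ((h1.mul tendsto_const_nhds).div_const _)
    simp only [zero_mul, add_zero, zero_div, sub_zero] at h2
    have h3 : ∀ᶠ k : ℕ in atTop,
        J / (2 * (A + (t - β) / k * B)) * ((t - β) - (t - β) / k * (χ t - χ β) / χ β) ≤
          (χ β)⁻¹ - (χ t)⁻¹ := by
      filter_upwards [eventually_gt_atTop 0] with k hk using key t hβt htc k hk
    have h4 := le_of_tendsto h2 h3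
    have h5 : 0 ≤ (χ t)⁻¹ := inv_nonneg.2 hχt.le
    linarith
  -- Step 3: let `t ↑ βc`
  have hgoal : J / (2 * A) * (βc - β) ≤ (χ β)⁻¹ := by
    have hcont : Tendsto (fun t => J / (2 * A) * (t - β)) (𝓝[<] βc) (𝓝 (J / (2 * A) * (βc - β))) :=
      ((continuous_const.mul (continuous_id.sub continuous_const)).tendsto βc).mono_left
        nhdsWithin_le_nhds
    refine le_of_tendsto hcont ?_
    filter_upwards [Ioo_mem_nhdsLT hβc] with t ht using hlim t ht.1 ht.2
  -- conclude
  have hgap : 0 < βc - β := sub_pos.2 hβc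
  have hc : 0 < J / (2 * A) := by positivity
  calc χ β = ((χ β)⁻¹)⁻¹ := (inv_inv _).symm
    _ ≤ (J / (2 * A) * (βc - β))⁻¹ := inv_anti₀ (by positivity) hgoal
    _ = 2 * A / J * (βc - β)⁻¹ := by rw [mul_inv]; field_simp

end Comparison

/-! ## Part C. The spread-out model in boxes: the differential inequality, and the limits -/

variable {d L : ℕ}

/-- **The constant `B₂ = |J| · B(β_c)`** (`|J| = deg 0 = (2L+1)^d - 1`, `B(β_c)` the bubble
diagram at the critical point): the uniform bound on the edge bubble of every box at every
`β ≤ β_c` (Tasaki–Hara, Lemma 10.11 / eq. (10.67): `Σ_{{u,v}} ⟨σ_oσ_u⟩⟨σ_oσ_v⟩ ≤ d B_L(β)`).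
[cite: TasakiHara2015, Ch. 10, eq. (10.67)] -/
def bubbleBoundConst (d L : ℕ) : ℝ :=
  ((spreadOutGraph d L).degree 0 : ℝ) * (bubbleDiagram d L (critBeta d L)).toReal

/-- `B₂ ≥ 0`. [folklore] -/
theorem bubbleBoundConst_nonneg (d L : ℕ) : 0 ≤ bubbleBoundConst d L :=
  mul_nonneg (Nat.cast_nonneg _) ENNReal.toReal_nonneg

/-- **The bubble diagram is nondecreasing in `β ≥ 0`** (termwise, GKS II). [cite: FriedliVelenik2017, Exercise 3.13] -/
theorem bubbleDiagram_mono : MonotoneOn (bubbleDiagram d L) (Set.Ici 0) := by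
  intro β hβ β' hβ' hle
  refine ENNReal.tsum_le_tsum fun x => ?_
  gcongr
  exact spreadOutTwoPoint_mono_beta x hβ hβ' hle

/-- **The on-site squares of a box are below the bubble diagram**: for `β ≥ 0`, `z ∈ ℤ^d` and a
box `Λ_n`, `Σ_{u ∈ Λ_n} ⟨σ_uσ_z⟩²_{Λ_n;β} ≤ B(β)` (termwise `⟨σ_uσ_z⟩_{Λ_n} ≤ G_β(z - u)`, and a
finite partial sum of the reindexed series is below it). [cite: TasakiHara2015, Ch. 10, eq. (10.67)] -/
theorem sum_sq_isingTwoPoint_le_bubbleDiagram {β : ℝ} (hβ : 0 ≤ β) {n : ℕ} {z : Site d}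
    (hz : z ∈ box d n) (hfin : bubbleDiagram d L β < ∞) :
    ∑ u ∈ box d n, isingTwoPoint (spreadOutGraph d L) (box d n) β 0 .free u z ^ 2 ≤
      (bubbleDiagram d L β).toReal := by
  have hterm : ∀ u ∈ box d n, isingTwoPoint (spreadOutGraph d L) (box d n) β 0 .free u z ^ 2 ≤
      spreadOutTwoPoint d L β (z - u) ^ 2 := fun u hu =>
    pow_le_pow_left₀ (isingTwoPoint_free_nonneg _ hβ hu hz)
      (isingTwoPoint_box_le_spreadOutTwoPoint hβ hu hz) 2
  have h1 : ∑ u ∈ box d n, isingTwoPoint (spreadOutGraph d L) (box d n) β 0 .free u z ^ 2 ≤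
      ∑ u ∈ box d n, spreadOutTwoPoint d L β (z - u) ^ 2 := Finset.sum_le_sum hterm
  refine h1.trans ?_
  -- compare the finite sum with the series in `[0, ∞]`
  have h2 : ENNReal.ofReal (∑ u ∈ box d n, spreadOutTwoPoint d L β (z - u) ^ 2) ≤ bubbleDiagram d L β := by
    rw [ENNReal.ofReal_sum_of_nonneg fun u _ => sq_nonneg _]
    calc ∑ u ∈ box d n, ENNReal.ofReal (spreadOutTwoPoint d L β (z - u) ^ 2)
        = ∑ u ∈ box d n, ENNReal.ofReal (spreadOutTwoPoint d L β (z - u)) ^ 2 :=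
          Finset.sum_congr rfl fun u _ => by
            rw [ENNReal.ofReal_pow (spreadOutTwoPoint_nonneg hβ _)]
      _ ≤ ∑' u : Site d, ENNReal.ofReal (spreadOutTwoPoint d L β (z - u)) ^ 2 := ENNReal.sum_le_tsum _
      _ = ∑' x : Site d, ENNReal.ofReal (spreadOutTwoPoint d L β x) ^ 2 :=
          (Equiv.subLeft z).tsum_eq (fun x => ENNReal.ofReal (spreadOutTwoPoint d L β x) ^ 2)
      _ = bubbleDiagram d L β := rfl
  exact (ENNReal.ofReal_le_iff_le_toReal hfin.ne).1 h2

/-- **The edge bubble of a box is at most `B₂`** for `0 ≤ β ≤ β_c` under the bubble condition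
(`b_Λ(z) ≤ |J| Σ_u ⟨σ_uσ_z⟩² ≤ |J| B(β) ≤ |J| B(β_c)`; Tasaki–Hara, Lemma 10.11 with (10.67)).
[cite: TasakiHara2015, Ch. 10, eq. (10.67)] -/
theorem edgeBubble_box_le {β : ℝ} (hβ : 0 ≤ β) (hβc : β ≤ critBeta d L) (hB : BubbleCondition d L)
    {n : ℕ} {z : Site d} (hz : z ∈ box d n) :
    edgeBubble (spreadOutGraph d L) (box d n) β z ≤ bubbleBoundConst d L := by
  have hmono : bubbleDiagram d L β ≤ bubbleDiagram d L (critBeta d L) :=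
    bubbleDiagram_mono hβ (hβ.trans hβc) hβc
  have hfin : bubbleDiagram d L β < ∞ := lt_of_le_of_lt hmono hB
  calc edgeBubble (spreadOutGraph d L) (box d n) β z
      ≤ ((spreadOutGraph d L).degree 0 : ℕ) *
          ∑ u ∈ box d n, isingTwoPoint (spreadOutGraph d L) (box d n) β 0 .free u z ^ 2 :=
        edgeBubble_le_degree_mul_sum_sq _ (fun a => (card_neighborFinset_spreadOutGraph d L a).le) z
    _ ≤ ((spreadOutGraph d L).degree 0 : ℕ) * (bubbleDiagram d L β).toReal :=
        mul_le_mul_of_nonneg_left (sum_sq_isingTwoPoint_le_bubbleDiagram hβ hz hfin) (Nat.cast_nonneg _)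
    _ ≤ bubbleBoundConst d L := by
        unfold bubbleBoundConst
        exact mul_le_mul_of_nonneg_left (ENNReal.toReal_mono hB.ne hmono) (Nat.cast_nonneg _)

/-- The box susceptibility `S_0^{Λ_n}(β)`, abbreviated. [cite: Sakai2007, §1.1 (finite-volume two-point function)] -/
abbrev boxSusceptibility (d L : ℕ) (β : ℝ) (n : ℕ) : ℝ :=
  volumeSusceptibility (spreadOutGraph d L) (box d n) β 0

/-- `S_0^{Λ_n}(β) = Σ_{y ∈ Λ_n} ⟨σ₀σ_y⟩_{Λ_n;β}`. [folklore] -/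
theorem boxSusceptibility_eq (β : ℝ) (n : ℕ) :
    boxSusceptibility d L β n = ∑ y ∈ box d n, boxTwoPoint d L β n y := rfl

/-- `S_0^{Λ_n}(β)` is nondecreasing in the box for `β ≥ 0`. [cite: FriedliVelenik2017, Exercise 3.12] -/
theorem boxSusceptibility_mono_volume {β : ℝ} (hβ : 0 ≤ β) :
    Monotone (boxSusceptibility d L β) := by
  refine monotone_nat_of_le_succ fun n => ?_
  rw [boxSusceptibility_eq, boxSusceptibility_eq]
  exact (Finset.sum_le_sum fun y _ => boxTwoPoint_mono_volume hβ y (Nat.le_succ n)).trans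
    (Finset.sum_le_sum_of_subset_of_nonneg (box_mono d (Nat.le_succ n))
      fun y _ _ => boxTwoPoint_nonneg hβ _ y)

/-- `S_0^{Λ_n}(β)` is nondecreasing in `β ≥ 0`. [cite: FriedliVelenik2017, Exercise 3.13] -/
theorem boxSusceptibility_mono_beta (n : ℕ) :
    MonotoneOn (fun β => boxSusceptibility d L β n) (Set.Ici 0) := by
  intro β hβ β' hβ' hle
  exact Finset.sum_le_sum fun y _ => boxTwoPoint_mono_beta n y hβ hβ' hle

/-- `S_0^{Λ_n}(β) ≥ 1` for `β ≥ 0`. [folklore] -/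
theorem one_le_boxSusceptibility {β : ℝ} (hβ : 0 ≤ β) (n : ℕ) : 1 ≤ boxSusceptibility d L β n := by
  rw [boxSusceptibility_eq, ← Finset.add_sum_erase _ _ (zero_mem_box d n), boxTwoPoint_zero_right]
  have : 0 ≤ ∑ y ∈ (box d n).erase 0, boxTwoPoint d L β n y :=
    Finset.sum_nonneg fun y _ => boxTwoPoint_nonneg hβ n y
  linarith

/-- **`S_0^{Λ_n}(β) ↑ χ_β`**: for `β ≥ 0` with `χ_β < ∞`, the box susceptibilities converge to
`χ_β` (monotone convergence; `χ_β = sup_n S_0^{Λ_n}(β)`). [cite: Sakai2007, §1.1 (monotone infinite-volume limit, χ_p)] -/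
theorem tendsto_boxSusceptibility {β : ℝ} (hβ : 0 ≤ β) (hfin : spreadOutSusceptibility d L β < ∞) :
    Tendsto (boxSusceptibility d L β) atTop (𝓝 (spreadOutSusceptibility d L β).toReal) := by
  have hsup : ⨆ n : ℕ, ENNReal.ofReal (boxSusceptibility d L β n) = spreadOutSusceptibility d L β :=
    le_antisymm (iSup_le fun n => ofReal_volumeSusceptibility_le_spreadOutSusceptibility hβ n)
      (spreadOutSusceptibility_le_iSup hβ)
  have hmono : Monotone fun n : ℕ => ENNReal.ofReal (boxSusceptibility d L β n) :=
    fun m n hmn => ENNReal.ofReal_le_ofReal (boxSusceptibility_mono_volume hβ hmn)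
  have h1 : Tendsto (fun n : ℕ => ENNReal.ofReal (boxSusceptibility d L β n)) atTop
      (𝓝 (spreadOutSusceptibility d L β)) := by
    rw [← hsup]; exact tendsto_atTop_iSup hmono
  have h2 := (ENNReal.tendsto_toReal hfin.ne).comp h1
  refine h2.congr fun n => ?_
  simp only [Function.comp_apply]
  exact ENNReal.toReal_ofReal (zero_le_one.trans (one_le_boxSusceptibility hβ n))

/-- **The finite-volume Aizenman–Graham inequality for boxes**: for `0 ≤ β ≤ β_c` under the
bubble condition, `M_{Λ_n}(0) - B₂ S_0^{Λ_n} ≤ (1 + B₂) dS_0^{Λ_n}/dβ` (from the general finite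
volume inequality with `b ≤ B₂` and `tanh β ≤ 1`). [cite: TasakiHara2015, Ch. 10, eqs. (10.64)–(10.68)] -/
theorem drivingTerm_box_sub_le (hAG : ∀ (n : ℕ) (β : ℝ), aizenmanGraham_inequality (spreadOutGraph d L) (box d n) β)
    {β : ℝ} (hβ : 0 ≤ β) (hβc : β ≤ critBeta d L) (hB : BubbleCondition d L) (n : ℕ) :
    drivingTerm (spreadOutGraph d L) (box d n) β 0 - bubbleBoundConst d L * boxSusceptibility d L β n ≤
      (1 + bubbleBoundConst d L) * deriv (fun β => boxSusceptibility d L β n) β := by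
  have h := drivingTerm_sub_le_deriv_volumeSusceptibility (spreadOutGraph d L) (hAG n β) hβ
    (zero_mem_box d n) (fun z hz => edgeBubble_box_le hβ hβc hB hz)
  have hderiv : 0 ≤ deriv (fun β => boxSusceptibility d L β n) β := by
    show 0 ≤ deriv (fun β => volumeSusceptibility (spreadOutGraph d L) (box d n) β 0) β
    rw [deriv_volumeSusceptibility_eq_sum_pairCov]
    refine mul_nonneg (by norm_num) (Finset.sum_nonneg fun y hy => Finset.sum_nonneg fun u hu =>
      Finset.sum_nonneg fun v hv => ?_)
    exact isingPairCov_free_nonneg _ hβ hu (Finset.mem_filter.1 hv).1 (zero_mem_box d n) hy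
  have hτ : Real.tanh β ≤ 1 := (Real.tanh_lt_one β).le
  have hB0 := bubbleBoundConst_nonneg d L
  calc drivingTerm (spreadOutGraph d L) (box d n) β 0 - bubbleBoundConst d L * boxSusceptibility d L β n
      ≤ (1 + Real.tanh β * bubbleBoundConst d L) * deriv (fun β => boxSusceptibility d L β n) β := h
    _ ≤ (1 + bubbleBoundConst d L) * deriv (fun β => boxSusceptibility d L β n) β := by
        refine mul_le_mul_of_nonneg_right ?_ hderiv
        nlinarith

/-- The driving term is nondecreasing in `β ≥ 0` (products of nonnegative nondecreasing
functions, GKS). [cite: FriedliVelenik2017, Exercise 3.13] -/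
theorem drivingTerm_box_mono (n : ℕ) :
    MonotoneOn (fun β => drivingTerm (spreadOutGraph d L) (box d n) β 0) (Set.Ici 0) := by
  intro β hβ β' hβ' hle
  refine Finset.sum_le_sum fun u hu => Finset.sum_le_sum fun v hv => ?_
  have hv' : v ∈ box d n := (Finset.mem_filter.1 hv).1
  refine mul_le_mul (boxTwoPoint_mono_beta n u hβ hβ' hle) ?_ ?_ (boxTwoPoint_nonneg hβ' n u)
  · exact Finset.sum_le_sum fun y hy =>
      isingTwoPoint_free_mono_beta (spreadOutGraph d L) hv' hy hβ hβ' hle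
  · exact Finset.sum_nonneg fun y hy => isingTwoPoint_free_nonneg _ hβ hv' hy

/-- **Integrated form (mean value theorem in finite volume)**: for `0 ≤ β₁ ≤ β₂ ≤ β_c` under the
bubble condition,
`(β₂ - β₁)(M_{Λ_n}(β₁) - B₂ S_0^{Λ_n}(β₂)) ≤ (1 + B₂)(S_0^{Λ_n}(β₂) - S_0^{Λ_n}(β₁))`
(the driving term being nondecreasing and the box susceptibility nondecreasing in `β`).
[cite: TasakiHara2015, Ch. 10, Thm. 10.13 (integration of (10.69))] -/
theorem boxSusceptibility_increment_ge
    (hAG : ∀ (n : ℕ) (β : ℝ), aizenmanGraham_inequality (spreadOutGraph d L) (box d n) β)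
    (hB : BubbleCondition d L) {β₁ β₂ : ℝ} (h0 : 0 ≤ β₁) (h12 : β₁ ≤ β₂) (h2c : β₂ ≤ critBeta d L)
    (n : ℕ) :
    (β₂ - β₁) * (drivingTerm (spreadOutGraph d L) (box d n) β₁ 0 -
        bubbleBoundConst d L * boxSusceptibility d L β₂ n) ≤
      (1 + bubbleBoundConst d L) * (boxSusceptibility d L β₂ n - boxSusceptibility d L β₁ n) := by
  set A := 1 + bubbleBoundConst d L with hA
  set f : ℝ → ℝ := fun β => A * boxSusceptibility d L β n with hf
  set Cst := drivingTerm (spreadOutGraph d L) (box d n) β₁ 0 -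
    bubbleBoundConst d L * boxSusceptibility d L β₂ n with hCst
  have hdiff : ∀ β, HasDerivAt (fun β => boxSusceptibility d L β n)
      (deriv (fun β => boxSusceptibility d L β n) β) β := fun β =>
    (hasDerivAt_volumeSusceptibility (spreadOutGraph d L) (box d n) β 0).differentiableAt.hasDerivAt
  have hfd : ∀ β, HasDerivAt f (A * deriv (fun β => boxSusceptibility d L β n) β) β :=
    fun β => (hdiff β).const_mul A
  have hcont : ContinuousOn f (Set.Icc β₁ β₂) := fun β _ => (hfd β).continuousAt.continuousWithinAt
  have hdiff' : DifferentiableOn ℝ f (interior (Set.Icc β₁ β₂)) := fun β _ =>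
    (hfd β).differentiableAt.differentiableWithinAt
  have hbound : ∀ β ∈ interior (Set.Icc β₁ β₂), Cst ≤ deriv f β := by
    intro β hβ
    rw [interior_Icc] at hβ
    have hβ0 : 0 ≤ β := h0.trans hβ.1.le
    rw [(hfd β).deriv]
    have h1 := drivingTerm_box_sub_le hAG hβ0 (hβ.2.le.trans h2c) hB n
    have h2 : drivingTerm (spreadOutGraph d L) (box d n) β₁ 0 ≤ drivingTerm (spreadOutGraph d L) (box d n) β 0 :=
      drivingTerm_box_mono n h0 hβ0 hβ.1.le
    have h3 : boxSusceptibility d L β n ≤ boxSusceptibility d L β₂ n :=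
      boxSusceptibility_mono_beta n hβ0 (hβ0.trans hβ.2.le) hβ.2.le
    have h4 := mul_le_mul_of_nonneg_left h3 (bubbleBoundConst_nonneg d L)
    simp only [hCst]
    linarith
  have := (convex_Icc β₁ β₂).mul_sub_le_image_sub_of_le_deriv hcont hdiff' hbound β₁
    (Set.left_mem_Icc.2 h12) β₂ (Set.right_mem_Icc.2 h12) h12
  simp only [hf] at this
  calc (β₂ - β₁) * Cst = Cst * (β₂ - β₁) := mul_comm _ _
    _ ≤ A * boxSusceptibility d L β₂ n - A * boxSusceptibility d L β₁ n := this
    _ = A * (boxSusceptibility d L β₂ n - boxSusceptibility d L β₁ n) := by ring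

/-- Neighbours are within sup-distance `L`: `v ∼ u`, `u ∈ Λ_m` imply `‖v‖_∞ ≤ m + L`. [folklore] -/
theorem supNorm_le_of_adj_of_mem_box {m : ℕ} {u v : Site d} (hu : u ∈ box d m)
    (huv : (spreadOutGraph d L).Adj u v) : Site.supNorm v ≤ m + L :=
  mem_box_iff_supNorm_le.1 (mem_box_add_of_adj hu huv)

/-- **Translated boxes inside a big box give a lower bound for `S_v`**: for `β ≥ 0`,
`‖v‖_∞ + m ≤ n`: `S_v^{Λ_n}(β) ≥ S_0^{Λ_m}(β)` (restrict the sum to `v + Λ_m ⊆ Λ_n`, transport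
by the translation `y ↦ y + v`, and GKS volume monotonicity `Λ_m + v ⊆ Λ_n`).
[cite: FriedliVelenik2017, Exercise 3.12] -/
theorem boxSusceptibility_le_volumeSusceptibility {β : ℝ} (hβ : 0 ≤ β) {m n : ℕ} {v : Site d}
    (hv : Site.supNorm v + m ≤ n) :
    boxSusceptibility d L β m ≤ volumeSusceptibility (spreadOutGraph d L) (box d n) β v := by
  set φ := (Site.shift v).toEmbedding with hφ
  have hφy : ∀ y : Site d, φ y = y + v := fun y => rfl
  have hsub : (box d m).map φ ⊆ box d n := (map_shift_box_subset m v).trans (box_mono d (by omega))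
  have hvn : v ∈ box d n := by
    have : φ 0 ∈ (box d m).map φ := Finset.mem_map_of_mem φ (zero_mem_box d m)
    rw [hφy, zero_add] at this
    exact hsub this
  -- restrict the sum over `Λ_n` to the image of `Λ_m`
  unfold volumeSusceptibility
  calc boxSusceptibility d L β m = ∑ y ∈ box d m, boxTwoPoint d L β m y := rfl
    _ ≤ ∑ y ∈ box d m, isingTwoPoint (spreadOutGraph d L) (box d n) β 0 .free v (φ y) := by
        refine Finset.sum_le_sum fun y hy => ?_
        -- transport `⟨σ₀σ_y⟩_{Λ_m} = ⟨σ_vσ_{y+v}⟩_{Λ_m + v}` and enlarge the volume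
        have hmap := isingTwoPoint_free_map (G := spreadOutGraph d L) (G' := spreadOutGraph d L) φ
          (Λ := box d m) (fun p _ q _ => spreadOutGraph_adj_shift_iff d L v p q) β 0 0 y
        rw [hφy 0, zero_add] at hmap
        rw [boxTwoPoint, ← hmap]
        exact isingTwoPoint_free_le_of_subset _ hβ (by
          have := Finset.mem_map_of_mem φ (zero_mem_box d m); rwa [hφy, zero_add] at this)
          (Finset.mem_map_of_mem φ hy) hsub
    _ = ∑ x ∈ (box d m).map φ, isingTwoPoint (spreadOutGraph d L) (box d n) β 0 .free v x := by
        rw [Finset.sum_map]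
    _ ≤ ∑ x ∈ box d n, isingTwoPoint (spreadOutGraph d L) (box d n) β 0 .free v x :=
        Finset.sum_le_sum_of_subset_of_nonneg hsub fun x hx _ =>
          isingTwoPoint_free_nonneg _ hβ hvn hx

/-- **Lower bound on the driving term by the square of a smaller box susceptibility**: for `β ≥ 0`
and `n ≥ 2m + L`, `M_{Λ_n}(0) ≥ |J| · S_0^{Λ_m}(β)²` (keep only `u ∈ Λ_m`, whose neighbours all lie
in `Λ_n`; `⟨σ₀σ_u⟩_{Λ_n} ≥ ⟨σ₀σ_u⟩_{Λ_m}` and `S_v^{Λ_n} ≥ S_0^{Λ_m}` for `‖v‖_∞ ≤ m + L`; every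
site has `|J|` neighbours). [cite: TasakiHara2015, Ch. 10, eq. (10.64) (the term 2d(χ/β)²)] -/
theorem degree_mul_sq_le_drivingTerm {β : ℝ} (hβ : 0 ≤ β) {m n : ℕ} (hmn : 2 * m + L ≤ n) :
    ((spreadOutGraph d L).degree 0 : ℝ) * boxSusceptibility d L β m ^ 2 ≤
      drivingTerm (spreadOutGraph d L) (box d n) β 0 := by
  have hmn' : m ≤ n := by omega
  have hS0 : 0 ≤ boxSusceptibility d L β m := zero_le_one.trans (one_le_boxSusceptibility hβ m)
  -- neighbours of `u ∈ Λ_m` lie in `Λ_n` and have `‖v‖ + m ≤ n`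
  have hnb : ∀ u ∈ box d m, ∀ v, (spreadOutGraph d L).Adj u v → v ∈ box d n ∧ Site.supNorm v + m ≤ n := by
    intro u hu v huv
    have h1 := supNorm_le_of_adj_of_mem_box hu huv
    exact ⟨mem_box_iff_supNorm_le.2 (by omega), by omega⟩
  unfold drivingTerm
  calc ((spreadOutGraph d L).degree 0 : ℝ) * boxSusceptibility d L β m ^ 2
      = ∑ u ∈ box d m, ((spreadOutGraph d L).degree 0 : ℝ) *
          (boxTwoPoint d L β m u * boxSusceptibility d L β m) := by
        rw [← Finset.mul_sum, ← Finset.sum_mul, ← boxSusceptibility_eq]; ring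
    _ = ∑ u ∈ box d m, ∑ v ∈ (spreadOutGraph d L).neighborFinset u,
          boxTwoPoint d L β m u * boxSusceptibility d L β m := by
        refine Finset.sum_congr rfl fun u _ => ?_
        rw [Finset.sum_const, card_neighborFinset_spreadOutGraph, nsmul_eq_mul]
    _ ≤ ∑ u ∈ box d m, ∑ v ∈ (spreadOutGraph d L).neighborFinset u,
          boxTwoPoint d L β n u * volumeSusceptibility (spreadOutGraph d L) (box d n) β v := by
        refine Finset.sum_le_sum fun u hu => Finset.sum_le_sum fun v hv => ?_
        have huv : (spreadOutGraph d L).Adj u v := (SimpleGraph.mem_neighborFinset _ _ _).1 hv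
        refine mul_le_mul (boxTwoPoint_mono_volume hβ u hmn')
          (boxSusceptibility_le_volumeSusceptibility hβ (hnb u hu v huv).2) hS0 (boxTwoPoint_nonneg hβ n u)
    _ = ∑ u ∈ box d m, ∑ v ∈ box d n with (spreadOutGraph d L).Adj u v,
          boxTwoPoint d L β n u * volumeSusceptibility (spreadOutGraph d L) (box d n) β v := by
        refine Finset.sum_congr rfl fun u hu => Finset.sum_congr ?_ fun _ _ => rfl
        ext v
        simp only [SimpleGraph.mem_neighborFinset, Finset.mem_filter]
        exact ⟨fun h => ⟨(hnb u hu v h).1, h⟩, fun h => h.2⟩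
    _ ≤ ∑ u ∈ box d n, ∑ v ∈ box d n with (spreadOutGraph d L).Adj u v,
          isingTwoPoint (spreadOutGraph d L) (box d n) β 0 .free 0 u *
            volumeSusceptibility (spreadOutGraph d L) (box d n) β v := by
        refine Finset.sum_le_sum_of_subset_of_nonneg (box_mono d hmn') fun u hu _ => ?_
        exact Finset.sum_nonneg fun v hv => mul_nonneg (boxTwoPoint_nonneg hβ n u)
          (Finset.sum_nonneg fun y hy => isingTwoPoint_free_nonneg _ hβ (Finset.mem_filter.1 hv).1 hy)

/-- **The increment inequality for the infinite-volume susceptibility**: for `d ≥ 2`, `L ≥ 1`,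
the bubble condition, the Aizenman–Graham inequality in every box, and `0 ≤ β₁ ≤ β₂ < β_c`,
`(β₂ - β₁)(|J| χ_{β₁}² - B₂ χ_{β₂}) ≤ (1 + B₂)(χ_{β₂} - χ_{β₁})`
(the finite-volume integrated inequality, the lower bound `M_{Λ_n} ≥ |J| (S_0^{Λ_m})²` for
`n ≥ 2m + L`, and the monotone limits `S_0^{Λ_n}(β) ↑ χ_β < ∞` below `β_c`).
[cite: TasakiHara2015, Ch. 10, Thm. 10.13 (integration of (10.69))] -/
theorem susceptibility_increment_ge (hd : 2 ≤ d) (hL : 1 ≤ L) (hB : BubbleCondition d L)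
    (hAG : ∀ (n : ℕ) (β : ℝ), aizenmanGraham_inequality (spreadOutGraph d L) (box d n) β)
    {β₁ β₂ : ℝ} (h0 : 0 ≤ β₁) (h12 : β₁ ≤ β₂) (h2c : β₂ < critBeta d L) :
    (β₂ - β₁) * (((spreadOutGraph d L).degree 0 : ℝ) * (spreadOutSusceptibility d L β₁).toReal ^ 2 -
        bubbleBoundConst d L * (spreadOutSusceptibility d L β₂).toReal) ≤
      (1 + bubbleBoundConst d L) *
        ((spreadOutSusceptibility d L β₂).toReal - (spreadOutSusceptibility d L β₁).toReal) := by
  obtain ⟨βp, hβp, hfinp⟩ := exists_pos_susceptibility_lt_top_holds d L hd hL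
  have hne : {β : ℝ | 0 ≤ β ∧ spreadOutSusceptibility d L β < ∞}.Nonempty := ⟨βp, hβp.le, hfinp⟩
  have h02 : 0 ≤ β₂ := h0.trans h12
  have hfin1 : spreadOutSusceptibility d L β₁ < ∞ :=
    susceptibility_lt_top_of_lt_critBeta hne h0 (h12.trans_lt h2c)
  have hfin2 : spreadOutSusceptibility d L β₂ < ∞ := susceptibility_lt_top_of_lt_critBeta hne h02 h2c
  set J : ℝ := ((spreadOutGraph d L).degree 0 : ℝ) with hJ
  set B₂ := bubbleBoundConst d L with hB₂
  set χ₁ := (spreadOutSusceptibility d L β₁).toReal with hχ₁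
  set χ₂ := (spreadOutSusceptibility d L β₂).toReal with hχ₂
  have hT1 := tendsto_boxSusceptibility (d := d) (L := L) h0 hfin1
  have hT2 := tendsto_boxSusceptibility (d := d) (L := L) h02 hfin2
  -- Step 1: for fixed `m`, let `n → ∞`
  have step1 : ∀ m : ℕ, (β₂ - β₁) * (J * boxSusceptibility d L β₁ m ^ 2 - B₂ * χ₂) ≤
      (1 + B₂) * (χ₂ - χ₁) := by
    intro m
    have hev : ∀ᶠ n : ℕ in atTop, (β₂ - β₁) * (J * boxSusceptibility d L β₁ m ^ 2 -
        B₂ * boxSusceptibility d L β₂ n) ≤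
        (1 + B₂) * (boxSusceptibility d L β₂ n - boxSusceptibility d L β₁ n) := by
      filter_upwards [eventually_ge_atTop (2 * m + L)] with n hn
      have h1 := boxSusceptibility_increment_ge hAG hB h0 h12 h2c.le n
      have h2 := degree_mul_sq_le_drivingTerm (d := d) (L := L) h0 hn
      have h3 : (β₂ - β₁) * (J * boxSusceptibility d L β₁ m ^ 2 - B₂ * boxSusceptibility d L β₂ n) ≤
          (β₂ - β₁) * (drivingTerm (spreadOutGraph d L) (box d n) β₁ 0 - B₂ * boxSusceptibility d L β₂ n) :=
        mul_le_mul_of_nonneg_left (by linarith) (sub_nonneg.2 h12)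
      exact h3.trans h1
    have hlim1 : Tendsto (fun n : ℕ => (β₂ - β₁) * (J * boxSusceptibility d L β₁ m ^ 2 -
        B₂ * boxSusceptibility d L β₂ n)) atTop (𝓝 ((β₂ - β₁) * (J * boxSusceptibility d L β₁ m ^ 2 - B₂ * χ₂))) :=
      tendsto_const_nhds.mul (tendsto_const_nhds.sub (tendsto_const_nhds.mul hT2))
    have hlim2 : Tendsto (fun n : ℕ => (1 + B₂) * (boxSusceptibility d L β₂ n - boxSusceptibility d L β₁ n))
        atTop (𝓝 ((1 + B₂) * (χ₂ - χ₁))) :=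
      tendsto_const_nhds.mul (hT2.sub hT1)
    exact le_of_tendsto_of_tendsto hlim1 hlim2 hev
  -- Step 2: let `m → ∞`
  have hlim1 : Tendsto (fun m : ℕ => (β₂ - β₁) * (J * boxSusceptibility d L β₁ m ^ 2 - B₂ * χ₂)) atTop
      (𝓝 ((β₂ - β₁) * (J * χ₁ ^ 2 - B₂ * χ₂))) :=
    tendsto_const_nhds.mul ((tendsto_const_nhds.mul (hT1.pow 2)).sub tendsto_const_nhds)
  exact le_of_tendsto hlim1 (Filter.Eventually.of_forall step1)

/-- `|J| = deg 0 ≥ 1` for `L ≥ 1`, `d ≥ 1` (the site `e₀` is a neighbour of the origin). [folklore] -/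
theorem one_le_degree_spreadOutGraph (hd : 1 ≤ d) (hL : 1 ≤ L) :
    1 ≤ (spreadOutGraph d L).degree 0 := by
  have hd' : 0 < d := hd
  set i₀ : Fin d := ⟨0, hd'⟩
  set e : Site d := Pi.single i₀ 1 with he
  have hadj : (spreadOutGraph d L).Adj 0 e := by
    rw [spreadOutGraph_adj_iff]
    refine ⟨fun h => ?_, fun i => ?_⟩
    · have := congrFun h i₀
      simp [he] at this
    · simp only [he, Pi.zero_apply, zero_sub, abs_neg]
      by_cases hi : i = i₀
      · subst hi; simp; exact_mod_cast hL
      · rw [Pi.single_eq_of_ne hi]; simp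
  rw [← SimpleGraph.card_neighborFinset_eq_degree]
  exact Finset.card_pos.2 ⟨e, (SimpleGraph.mem_neighborFinset _ _ _).2 hadj⟩

/-! ## Part D. Assembly: `bubble_susceptibility_upper` from the Aizenman–Graham inequality -/

/-- **Aizenman's bubble bound from the Aizenman–Graham inequality** (Tasaki–Hara 2015,
Thm. 10.13, upper bound of (10.60), along (10.63)–(10.69); Aizenman 1982, Aizenman–Graham 1983 as
quoted by Sakai 2007, §1.1): granted the finite-volume Aizenman–Graham inequality in the boxes
of the spread-out model, for `d ≥ 2`, `L ≥ 1` and `B(β_c) < ∞` there are `C` and `β₀ < β_c` with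
`χ_β ≤ C (β_c - β)⁻¹` on `(β₀, β_c)`; here `C = 2(1 + |J|B(β_c))/|J|` and `β₀` is any point with
`χ_{β₀} ≥ 2B(β_c)` (which exists as `χ_β ↑ ∞`). The printed argument uses periodic boundary
conditions; here the free-boundary finite-volume inequality is integrated and the volume limit
is taken with the monotone convergence of the finite-volume two-point functions.
[cite: TasakiHara2015, Ch. 10, Thm. 10.13 and eqs. (10.63)–(10.69)]
[cite: Sakai2007, §1.1 (bubble condition ⇒ γ = 1)] [cite: AizenmanGraham1983, as cited by Tasaki–Hara 2015 ([52])] -/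
theorem bubble_susceptibility_upper_of_aizenmanGraham
    (hAG : ∀ (d L n : ℕ) (β : ℝ), aizenmanGraham_inequality (spreadOutGraph d L) (box d n) β) :
    bubble_susceptibility_upper := by
  intro d L hd hL hBC
  obtain ⟨βp, hβp, hfinp⟩ := exists_pos_susceptibility_lt_top_holds d L hd hL
  have hne : {β : ℝ | 0 ≤ β ∧ spreadOutSusceptibility d L β < ∞}.Nonempty := ⟨βp, hβp.le, hfinp⟩
  set J : ℝ := ((spreadOutGraph d L).degree 0 : ℝ) with hJ
  set B₂ := bubbleBoundConst d L with hB₂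
  set A : ℝ := 1 + B₂ with hA
  have hB0 : 0 ≤ B₂ := bubbleBoundConst_nonneg d L
  have hJ1 : 1 ≤ J := by
    have := one_le_degree_spreadOutGraph (d := d) (L := L) (by omega) hL
    rw [hJ]; exact_mod_cast this
  have hJ0 : 0 < J := by linarith
  have hA0 : 0 < A := by linarith
  -- `β₀ ∈ [0, β_c)` with `J χ(β₀) ≥ 2 B₂`
  obtain ⟨β₀, hβ₀0, hβ₀c, hM⟩ := susceptibility_unbounded_below_critBeta_holds d L hd hL
    (ENNReal.ofReal (2 * B₂ / J)) ENNReal.ofReal_lt_top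
  have hfin0 : spreadOutSusceptibility d L β₀ < ∞ := susceptibility_lt_top_of_lt_critBeta hne hβ₀0 hβ₀c
  have hbig : 2 * B₂ ≤ J * (spreadOutSusceptibility d L β₀).toReal := by
    have h1 : 2 * B₂ / J ≤ (spreadOutSusceptibility d L β₀).toReal :=
      (ENNReal.ofReal_le_iff_le_toReal hfin0.ne).1 hM
    rw [div_le_iff₀ hJ0] at h1
    linarith
  set χ : ℝ → ℝ := fun β => (spreadOutSusceptibility d L β).toReal with hχ
  refine ⟨2 * A / J, β₀, hβ₀c, fun β hβl hβc => ?_⟩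
  have hβ0 : 0 ≤ β := hβ₀0.trans hβl.le
  have hfin : spreadOutSusceptibility d L β < ∞ := susceptibility_lt_top_of_lt_critBeta hne hβ0 hβc
  have key : χ β ≤ 2 * A / J * (critBeta d L - β)⁻¹ := by
    refine le_inv_of_increment_ge (χ := χ) (β₀ := β₀) (βc := critBeta d L) hA0 hJ0 hB0
      ?_ ?_ hbig ?_ hβl.le hβc
    · intro t ht htc
      exact one_le_susceptibility_toReal (susceptibility_lt_top_of_lt_critBeta hne (hβ₀0.trans ht) htc)
    · intro s t hs hst htc
      have hs0 : 0 ≤ s := hβ₀0.trans hs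
      exact ENNReal.toReal_mono (susceptibility_lt_top_of_lt_critBeta hne (hs0.trans hst) htc).ne
        (susceptibility_mono hs0 (hs0.trans hst) hst)
    · intro s t hs hst htc
      exact susceptibility_increment_ge hd hL hBC (hAG d L) (hβ₀0.trans hs) hst htc
  rw [← ENNReal.ofReal_toReal hfin.ne]
  exact ENNReal.ofReal_le_ofReal key

end Literature.Barriers.CriticalPhenomena.SpreadOutIsing

end
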